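import Literature.AlgebraicGeometry.Resolution.BertiniRegularLocus
import Literature.AlgebraicGeometry.Resolution.RegularLocalRingsJacobian
import Literature.AlgebraicGeometry.Resolution.RegularLocalRingsQuotient
import Literature.AlgebraicGeometry.Resolution.RegularLocalRingsProofs
import Mathlib.RingTheory.KrullDimension.Regular
import Mathlib.RingTheory.Ideal.Quotient.Nilpotent
import Mathlib.LinearAlgebra.Dual.Lemmas
import HarnessLib

/-!
# [OURS · L1 W4.5(b)] Helper H-L0b `occurs_as_singular_locus` for the crux `EquisingularLiftNat`
# (EL♮, stmt-ResolutionOfSingularities-20038), line `sections`, research stub `stub_elnat_three`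

NOT a statement of any manuscript. Helper file of the chain res-L1-w45b (CRUX-PLAN v3.0.1 §1.3 (b) /
§4 «H-L0b `occurs_as_singular_locus` (§1.3 (b): generic `G ∈ 𝓘_Σ²(d)` integral with `Sing = Σ`;
uses Bertini; M)», CHAIN v6.2 §3), in the chain's AFFINE LOCAL-ALGEBRA BERTINI CURRENCY (the shape
of `StrataSplit.stub_bertiniWithBaseCurve` and of the tree theorem
`Literature.AlgebraicGeometry.Resolution.BertiniAffine.isGeneric_isRegularLocalRing_quotient_linComb`).

**What is proved (the «Sing H = Σ» clause of §1.3 (b), chart by chart).** Let `A` be a regular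
domain of finite type over an algebraically closed field `k` (an affine chart of `ℙ³_k`, or of any
smooth variety) and `𝔭 ⊂ A` a non-zero ideal (the chart of the curve `Σ`; no primality or
dimension hypothesis is needed for this clause).

* `isGeneric_isRegularLocalRing_quotient_linComb_off` — **Bertini off a closed set**: if finitely
  many `uⱼ ∈ A` separate tangent vectors at the closed points OFF `V(𝔭)` (`t ↦ Σ tⱼuⱼ mod 𝔪²` onto
  `A ⧸ 𝔪²` for maximal `𝔪 ⊉ 𝔭`), then for generic `t` the hypersurface `V(s_t)`, `s_t = Σ tⱼ uⱼ`, is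
  regular at each of its closed points off `V(𝔭)` (cover `Spec A ∖ V(𝔭)` by basic opens `D(g)`, `g`
  over generators of `𝔭`; the tree's Bertini on each `A_g`; intersect the generic conditions).
* `not_isRegularLocalRing_quotient_of_mem_sq` — **singular along `𝔭`**: for `0 ≠ s ∈ 𝔪²` the
  local ring `A_𝔪 ⧸ (s)` is not regular (Matsumura 14.2); so members of `𝔭²` are singular on `V(𝔭)`.
* `exists_sqSystem` — the affine chart of `|𝓘_Σ²(d)|`, `d ≫ 0`: the products `g · 1`, `g · xᵢ`
  (`g` over generators of `𝔭²`, `xᵢ` over `k`-algebra generators of `A`) lie in `𝔭²`, separate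
  tangent vectors off `V(𝔭)`, and one of them is non-zero.
* `occurs_as_singular_locus` — **H-L0b, affine kernel core**: there are finitely many `uⱼ ∈ 𝔭²`
  such that for GENERIC `t` (`IsGeneric`; non-vacuous, `k` infinite) `s_t ≠ 0`, `s_t ∈ 𝔭²`, and for
  every closed point `𝔪 ∋ s_t`: `A_𝔪 ⧸ (s_t)` is regular **iff** `𝔪 ⊉ 𝔭` — the closed singular
  points of the generic member `H = V(s_t)` of the `𝔭²`-system are exactly those of `V(𝔭) ⊆ H`.

**Not covered here, and said so** (CRUX-PLAN v3.0.1 §1.3 (b) asks for more): integrality of `H`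
for `d ≫ 0` (irreducibility fails for small `d`: two planes through a line), «transversal type `A₁`
off finitely many points of `Σ`», and the projective gluing of the affine charts of `ℙ³` (a finite
intersection of generic conditions on one coefficient space). These remain the M-class parts.
References: Hartshorne, *Algebraic Geometry* II Thm. 8.18 [Hartshorne1977]; Matsumura,
*Commutative Ring Theory* Thm. 14.2 [Matsumura1987].
-/

set_option linter.dupNamespace false -- mandated namespace `Summit.<Summit>.<Problem>` of this single-conjunct summit

noncomputable section

open IsLocalRing MvPolynomial

universe u v

namespace Summit.ResolutionOfSingularities.ResolutionOfSingularities.Cruxes.EquisingularLiftNat.Sections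

open Literature.AlgebraicGeometry.Resolution Literature.AlgebraicGeometry.Resolution.BertiniAffine

variable {k : Type u} [Field k] {A : Type u} [CommRing A] [Algebra k A]
variable {ι : Type v} [Fintype ι]

/-- In a regular local ring `R`, for `0 ≠ x ∈ 𝔪²` the hypersurface ring `R ⧸ (x)` is NOT regular:
its embedding dimension is that of `R` (`x ∈ 𝔪²` does not lower it) while its dimension is one
less (`x` is a non-zero-divisor of the domain `R`). [cite: Matsumura1987, Thm. 14.2]
[OURS · L1 W4.5b] helper for H-L0b; NOT a statement of the manuscript. -/
theorem not_isRegularLocalRing_quotient_span_singleton_of_mem_sq {R : Type u} [CommRing R]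
    [IsRegularLocalRing R] {x : R} (hx0 : x ≠ 0) (hx2 : x ∈ maximalIdeal R ^ 2) :
    ¬ IsRegularLocalRing (R ⧸ Ideal.span {x}) := by
  intro hreg
  haveI : IsDomain R := isDomain_of_isRegularLocalRing R
  have hxm : x ∈ maximalIdeal R := Ideal.pow_le_self two_ne_zero hx2
  have hdim : ringKrullDim (R ⧸ Ideal.span {x}) + 1 = ringKrullDim R :=
    ringKrullDim_quotient_span_singleton_succ_eq_ringKrullDim_of_mem_nonZeroDivisors
      (mem_nonZeroDivisors_of_ne_zero hx0) hxm
  haveI : Nontrivial (R ⧸ Ideal.span {x}) :=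
    Ideal.Quotient.nontrivial_iff.mpr (by
      rw [Ne, Ideal.span_singleton_eq_top]
      exact fun hu => (mem_maximalIdeal _).mp hxm hu)
  have hemb := spanFinrank_maximalIdeal_le_spanFinrank_map_of_mem_sq hx2
  rw [← maximalIdeal_quotient_eq_map (Ideal.span {x})] at hemb
  have h1 : ((maximalIdeal R).spanFinrank : WithBot ℕ∞) = ringKrullDim R :=
    IsRegularLocalRing.spanFinrank_maximalIdeal
  have h2 : ((maximalIdeal (R ⧸ Ideal.span {x})).spanFinrank : WithBot ℕ∞) =
      ringKrullDim (R ⧸ Ideal.span {x}) :=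
    IsRegularLocalRing.spanFinrank_maximalIdeal
  obtain ⟨n, hn⟩ := exists_nat_cast_eq_ringKrullDim (R := R ⧸ Ideal.span {x})
  rw [hn] at hdim h2
  rw [← hdim] at h1
  have h1' : (maximalIdeal R).spanFinrank = n + 1 := by exact_mod_cast h1
  have h2' : (maximalIdeal (R ⧸ Ideal.span {x})).spanFinrank = n := by exact_mod_cast h2
  omega

/-- **A hypersurface through `𝔪` to second order is singular at `𝔪`**: in a regular domain `A`,
for a maximal ideal `𝔪` and `0 ≠ s ∈ 𝔪²`, the local ring `A_𝔪 ⧸ (s)` of `V(s)` at `𝔪` is not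
regular. Applied with `s ∈ 𝔭² ⊆ 𝔪²` for `𝔪 ⊇ 𝔭`: every member of `𝔭²` is singular along `V(𝔭)`.
[cite: Matsumura1987, Thm. 14.2] [OURS · L1 W4.5b] helper for H-L0b; NOT a statement of the
manuscript. -/
theorem not_isRegularLocalRing_quotient_of_mem_sq [IsRegularRing A] [IsDomain A]
    (𝔪 : Ideal A) [𝔪.IsMaximal] {s : A} (hs0 : s ≠ 0) (hs2 : s ∈ 𝔪 ^ 2) :
    ¬ IsRegularLocalRing (Localization.AtPrime 𝔪 ⧸
        Ideal.span {algebraMap A (Localization.AtPrime 𝔪) s}) := by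
  have hinj : Function.Injective (algebraMap A (Localization.AtPrime 𝔪)) :=
    IsLocalization.injective (Localization.AtPrime 𝔪) (Ideal.primeCompl_le_nonZeroDivisors 𝔪)
  have h0 : algebraMap A (Localization.AtPrime 𝔪) s ≠ 0 := fun h =>
    hs0 (hinj (by rw [h, map_zero]))
  have h2 : algebraMap A (Localization.AtPrime 𝔪) s ∈
      maximalIdeal (Localization.AtPrime 𝔪) ^ 2 := by
    rw [← Localization.AtPrime.map_eq_maximalIdeal, ← Ideal.map_pow]
    exact Ideal.mem_map_of_mem _ hs2
  exact not_isRegularLocalRing_quotient_span_singleton_of_mem_sq h0 h2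

/-- **A generic member of a linear system is non-zero** as soon as one of the spanning functions
is: `s_t ≠ 0` for generic `t` if some `uⱼ ≠ 0` (test against a linear functional `φ` with
`φ(uⱼ) ≠ 0`, `BertiniAffine.isGeneric_ne_zero_of_linearMap`). [folklore]
[OURS · L1 W4.5b] helper for H-L0b. -/
theorem isGeneric_linComb_ne_zero (u : ι → A) (h : ∃ j, u j ≠ 0) :
    IsGeneric fun t : ι → k => linComb u t ≠ 0 := by
  classical
  obtain ⟨j, hj⟩ := h
  obtain ⟨φ, hφ⟩ := Module.Projective.exists_dual_ne_zero k hj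
  let L : (ι → k) →ₗ[k] A := Fintype.linearCombination k u
  have hL : ∀ t, L t = linComb u t := fun t => by
    simp only [L, Fintype.linearCombination_apply, linComb]
  let ψ : (ι → k) →ₗ[k] k := φ ∘ₗ L
  have hψ : ψ ≠ 0 := by
    intro h0
    apply hφ
    have h1 : ψ (Pi.single j 1) = 0 := by rw [h0, LinearMap.zero_apply]
    have h2 : L (Pi.single j 1) = u j := by
      rw [hL]
      simp [linComb, Pi.single_apply, Finset.sum_ite_eq', Finset.mem_univ]
    simpa [ψ, h2] using h1
  refine (isGeneric_ne_zero_of_linearMap ψ hψ).mono fun t ht h0 => ht ?_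
  change φ (L t) = 0
  rw [hL, h0, map_zero]

set_option synthInstance.maxHeartbeats 80000 in
set_option maxHeartbeats 800000 in
/-- **Bertini's theorem off a closed set** (Hartshorne II.8.18 for the nonsingular quasi-projective
scheme `Spec A ∖ V(𝔭)`): let `A` be a regular algebra of finite type over an algebraically closed
field `k`, `𝔭 ⊆ A` an ideal and `u : ι → A` finitely many functions such that at every closed point
`𝔪 ⊉ 𝔭` the linear map `t ↦ Σ tⱼ uⱼ mod 𝔪²`, `kᶥ → A ⧸ 𝔪²`, is surjective (NO hypothesis at the
closed points of `V(𝔭)`). Then for generic `t ∈ kᶥ` the hyperplane section `V(s_t)`, `s_t = Σ tⱼ uⱼ`,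
is regular at each of its closed points OFF `V(𝔭)`: `A_𝔪 ⧸ (s_t)` is a regular local ring for every
maximal `𝔪 ∋ s_t` with `𝔪 ⊉ 𝔭`. Proof: `Spec A ∖ V(𝔭) = ⋃ D(g)`, `g` over a finite generating set of
`𝔭`; the tree's `BertiniAffine.isGeneric_isRegularLocalRing_quotient_linComb` applies to each regular
`A_g` (`u` still separates tangent vectors there, `BertiniAffine.quotient_sq_map_away_surjective`);
transfer along `(A_g)_{𝔪A_g} ≅ A_𝔪` and intersect (`IsGeneric.forall_mem_finite`). [cite:
Hartshorne1977, II Thm. 8.18] [OURS · L1 W4.5b] helper for H-L0b; NOT a statement of the manuscript. -/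
theorem isGeneric_isRegularLocalRing_quotient_linComb_off [IsAlgClosed k] [IsRegularRing A]
    [Algebra.FiniteType k A] (𝔭 : Ideal A) (u : ι → A)
    (hoff : ∀ 𝔪 : Ideal A, 𝔪.IsMaximal → ¬ 𝔭 ≤ 𝔪 →
      Function.Surjective (linCombQuotSq (k := k) u 𝔪)) :
    IsGeneric fun t : ι → k => ∀ (𝔪 : Ideal A) [𝔪.IsMaximal], ¬ 𝔭 ≤ 𝔪 → linComb u t ∈ 𝔪 →
      IsRegularLocalRing (Localization.AtPrime 𝔪 ⧸
        Ideal.span {algebraMap A (Localization.AtPrime 𝔪) (linComb u t)}) := by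
  classical
  -- a finite generating set `S` of `𝔭`: `Spec A ∖ V(𝔭) = ⋃_{g ∈ S} D(g)`
  obtain ⟨S, hS⟩ := (IsNoetherian.noetherian 𝔭 : 𝔭.FG)
  -- Bertini for each piece `A_g`, `g ∈ 𝔭`
  have hpiece : ∀ g : A, g ∈ 𝔭 → IsGeneric fun t : ι → k => ∀ (𝔪 : Ideal A) [𝔪.IsMaximal],
      g ∉ 𝔪 → linComb u t ∈ 𝔪 →
        IsRegularLocalRing (Localization.AtPrime 𝔪 ⧸
          Ideal.span {algebraMap A (Localization.AtPrime 𝔪) (linComb u t)}) := by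
    intro g hg𝔭
    let Ag := Localization.Away g
    -- `A_g` is regular, of finite type, and `u` separates tangent vectors at its closed points
    haveI : IsNoetherianRing Ag :=
      IsLocalization.isNoetherianRing (Submonoid.powers g) Ag inferInstance
    haveI : IsRegularRing Ag := by
      refine (isRegularRing_iff (R := Ag)).2 fun P hP => ?_
      haveI := hP
      haveI : IsLocalization.AtPrime (Localization.AtPrime P) (P.under A) :=
        IsLocalization.isLocalization_isLocalization_atPrime_isLocalization
          (Submonoid.powers g) (Localization.AtPrime P) P
      exact IsRegularLocalRing.of_ringEquiv (R := Localization.AtPrime (P.under A))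
        (IsLocalization.algEquiv (P.under A).primeCompl (Localization.AtPrime (P.under A))
          (Localization.AtPrime P)).toRingEquiv
    haveI : Algebra.FiniteType A Ag := IsLocalization.finiteType_of_monoid_fg (Submonoid.powers g) Ag
    haveI : Algebra.FiniteType k Ag := Algebra.FiniteType.trans (S := A) inferInstance inferInstance
    let ug : ι → Ag := fun j => algebraMap A Ag (u j)
    have hug : ∀ 𝔫 : Ideal Ag, 𝔫.IsMaximal → Function.Surjective (linCombQuotSq (k := k) ug 𝔫) := by
      intro 𝔫 h𝔫
      haveI := h𝔫
      haveI : (𝔫.under A).IsMaximal := isMaximal_under_of_isMaximal' (K := k) (T := A) 𝔫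
      have hgn : g ∉ 𝔫.under A := fun hmem => h𝔫.ne_top
        (𝔫.eq_top_of_isUnit_mem (Ideal.mem_comap.1 hmem) (IsLocalization.Away.algebraMap_isUnit g))
      -- `𝔫 ∩ A ⊉ 𝔭` because `g ∈ 𝔭 ∖ 𝔫`
      have hp𝔫 : ¬ 𝔭 ≤ 𝔫.under A := fun hle => hgn (hle hg𝔭)
      have h𝔫eq : (𝔫.under A).map (algebraMap A Ag) = 𝔫 :=
        IsLocalization.map_under (Submonoid.powers g) Ag 𝔫
      intro y
      -- `A ⧸ 𝔪² ↠ A_g ⧸ (𝔪A_g)² = A_g ⧸ 𝔫²`, `𝔪 = 𝔫 ∩ A`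
      have hsurj := quotient_sq_map_away_surjective g (𝔫.under A) hgn
      let e₂ : Ag ⧸ ((𝔫.under A).map (algebraMap A Ag)) ^ 2 ≃+* Ag ⧸ 𝔫 ^ 2 :=
        Ideal.quotEquivOfEq (by rw [h𝔫eq])
      obtain ⟨a, ha⟩ := hsurj (e₂.symm y)
      obtain ⟨t, rfl⟩ := hoff (𝔫.under A) inferInstance hp𝔫 a
      refine ⟨t, ?_⟩
      have h1 : linCombQuotSq (k := k) ug 𝔫 t = e₂ (Ideal.quotientMap
          (((𝔫.under A).map (algebraMap A Ag)) ^ 2) (algebraMap A Ag)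
          (sq_le_comap_map_sq g _) (linCombQuotSq (k := k) u (𝔫.under A) t)) := by
        rw [linCombQuotSq_apply, linCombQuotSq_apply, Ideal.quotientMap_mk, linComb_comp_algebraMap]
        exact (Ideal.quotEquivOfEq_mk _ _).symm
      rw [h1, ha, RingEquiv.apply_symm_apply]
    have hB := isGeneric_isRegularLocalRing_quotient_linComb (k := k) (A := Ag) (u := ug) hug
    refine hB.mono fun t ht 𝔪 h𝔪 hgm hst => ?_
    -- transfer from `(A_g)_{𝔪 A_g}` to `A_𝔪`
    obtain ⟨h𝔫max, h𝔫under⟩ := isMaximal_map_away g 𝔪 hgm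
    set 𝔫 := 𝔪.map (algebraMap A Ag) with h𝔫def
    haveI := h𝔫max
    have hst' : linComb ug t ∈ 𝔫 := by
      rw [linComb_comp_algebraMap]; exact Ideal.mem_map_of_mem _ hst
    have hreg := ht 𝔫 hst'
    haveI : IsLocalization.AtPrime (Localization.AtPrime 𝔫) (𝔫.under A) :=
      IsLocalization.isLocalization_isLocalization_atPrime_isLocalization
        (Submonoid.powers g) (Localization.AtPrime 𝔫) 𝔫
    have hpc : (𝔫.under A).primeCompl = 𝔪.primeCompl := by
      ext x; rw [Ideal.mem_primeCompl_iff, Ideal.mem_primeCompl_iff, h𝔫under]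
    haveI : IsLocalization.AtPrime (Localization.AtPrime 𝔫) 𝔪 := by
      change IsLocalization 𝔪.primeCompl _
      rw [← hpc]; exact this
    let e : Localization.AtPrime 𝔫 ≃ₐ[A] Localization.AtPrime 𝔪 :=
      IsLocalization.algEquiv 𝔪.primeCompl (Localization.AtPrime 𝔫) (Localization.AtPrime 𝔪)
    have hx : e (algebraMap Ag (Localization.AtPrime 𝔫) (linComb ug t)) =
        algebraMap A (Localization.AtPrime 𝔪) (linComb u t) := by
      rw [linComb_comp_algebraMap, ← IsScalarTower.algebraMap_apply, e.commutes]
    haveI := hreg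
    refine IsRegularLocalRing.of_ringEquiv (R := Localization.AtPrime 𝔫 ⧸
      Ideal.span {algebraMap Ag (Localization.AtPrime 𝔫) (linComb ug t)}) ?_
    refine Ideal.quotientEquiv _ _ e.toRingEquiv ?_
    rw [Ideal.map_span, Set.image_singleton]
    exact congrArg (fun z => Ideal.span {z}) hx.symm
  -- put the pieces together
  have hall := IsGeneric.forall_mem_finite (k := k) (S : Set A).toFinite
    fun g hg => hpiece g (hS ▸ Ideal.subset_span hg)
  refine hall.mono fun t ht 𝔪 h𝔪 hp𝔪 hst => ?_
  -- some generator of `𝔭` is a unit at `𝔪`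
  have hex : ∃ g ∈ (S : Set A), g ∉ 𝔪 := by
    by_contra hcon
    push Not at hcon
    exact hp𝔪 (hS ▸ Ideal.span_le.2 hcon)
  obtain ⟨g, hgS, hg𝔪⟩ := hex
  exact ht g hgS 𝔪 hg𝔪 hst

/-! ## The `𝔭²`-system separates tangent vectors off `V(𝔭)`

The affine chart of the linear system `|𝓘_Σ²(d)|`, `d ≥ max deg g + 1`, is the family of products
`g · 1`, `g · xᵢ` for `g` in a finite set `T` of generators of `𝔭²` and `xᵢ` in a finite set `s` of
`k`-algebra generators of `A`; it is written inline as
`fun p : ↥T × Option ↥s => (p.1 : A) * p.2.elim 1 Subtype.val` (no auxiliary definition, so that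
this file stays definition-free). -/

/-- **The `𝔭²`-system separates tangent vectors off `V(𝔭)`**: for `T` generating `𝔭²` as an
ideal, `s` generating `A` as a `k`-algebra (`k` algebraically closed, `A` of finite type), and a
maximal `𝔪 ⊉ 𝔭`, the map `t ↦ s_t mod 𝔪²` of the system `{g · 1, g · xᵢ}` is onto `A ⧸ 𝔪²`: some
generator `g ∈ T` is a unit modulo `𝔪²`, and `1, x₁, …, xₙ` already separate tangent vectors
(`BertiniAffine.surjective_linCombQuotSq_of_adjoin_eq_top`). [folklore]
[OURS · L1 W4.5b] helper for H-L0b. -/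
theorem surjective_linCombQuotSq_sqSystem [IsAlgClosed k] [Algebra.FiniteType k A]
    {T s : Finset A} {𝔭 : Ideal A} (hT : Ideal.span (T : Set A) = 𝔭 ^ 2)
    (hs : Algebra.adjoin k (s : Set A) = ⊤) (𝔪 : Ideal A) [𝔪.IsMaximal] (hp𝔪 : ¬ 𝔭 ≤ 𝔪) :
    Function.Surjective (linCombQuotSq (k := k)
      (fun p : ↥T × Option ↥s => (p.1 : A) * p.2.elim 1 Subtype.val) 𝔪) := by
  classical
  -- a generator `g ∈ T` outside `𝔪`
  have hex : ∃ g ∈ (T : Set A), g ∉ 𝔪 := by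
    by_contra hcon
    push Not at hcon
    have h2 : 𝔭 ^ 2 ≤ 𝔪 := hT ▸ Ideal.span_le.2 hcon
    exact hp𝔪 ((Ideal.IsPrime.pow_le_iff two_ne_zero).1 h2)
  obtain ⟨g, hgT, hg𝔪⟩ := hex
  -- `1, x₁, …, xₙ` separate tangent vectors at `𝔪`
  have hgen : Algebra.adjoin k (Set.range (fun o : Option ↥s => o.elim (1 : A) Subtype.val)) = ⊤ := by
    refine top_le_iff.1 (hs ▸ Algebra.adjoin_mono fun x hx => ?_)
    exact ⟨some ⟨x, hx⟩, rfl⟩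
  have hv : Function.Surjective
      (linCombQuotSq (k := k) (fun o : Option ↥s => o.elim (1 : A) Subtype.val) 𝔪) :=
    surjective_linCombQuotSq_of_adjoin_eq_top _ hgen (j₀ := none) rfl 𝔪
  -- `g` is a unit modulo `𝔪²`
  have hunit : IsUnit (Ideal.Quotient.mk (𝔪 ^ 2) g) :=
    (Ideal.Quotient.isUnit_mk_pow_iff_notMem 𝔪 two_ne_zero).2 hg𝔪
  obtain ⟨b, hb⟩ := hunit.exists_right_inv
  intro y
  obtain ⟨t', ht'⟩ := hv (b * y)
  -- the coefficient vector supported on `{g} × Option ↥s`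
  let t : ↥T × Option ↥s → k := fun p => if p.1 = ⟨g, hgT⟩ then t' p.2 else 0
  have hlin : linComb (fun p : ↥T × Option ↥s => (p.1 : A) * p.2.elim 1 Subtype.val) t =
      g * linComb (fun o : Option ↥s => o.elim (1 : A) Subtype.val) t' := by
    unfold linComb
    rw [Fintype.sum_prod_type, Finset.sum_eq_single (⟨g, hgT⟩ : ↥T), Finset.mul_sum]
    · refine Finset.sum_congr rfl fun o _ => ?_
      simp only [t, if_true, mul_smul_comm]
    · intro a _ ha
      refine Finset.sum_eq_zero fun o _ => ?_
      simp only [t]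
      rw [if_neg ha, zero_smul]
    · intro h
      exact absurd (Finset.mem_univ _) h
  refine ⟨t, ?_⟩
  rw [linCombQuotSq_apply, hlin, map_mul, ← linCombQuotSq_apply, ht', ← mul_assoc, hb, one_mul]

/-- **Existence of the affine `𝔭²`-system**: for `A` of finite type over an algebraically closed
field `k`, a domain, and a non-zero ideal `𝔭`, there are finitely many `uⱼ ∈ 𝔭²`, one of them
non-zero, separating tangent vectors at every closed point off `V(𝔭)`. [folklore]
[OURS · L1 W4.5b] helper for H-L0b. -/
theorem exists_sqSystem [IsAlgClosed k] [Algebra.FiniteType k A] [IsDomain A]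
    [IsNoetherianRing A] (𝔭 : Ideal A) (h𝔭 : 𝔭 ≠ ⊥) :
    ∃ (ι : Type u) (_ : Fintype ι) (u : ι → A), (∀ j, u j ∈ 𝔭 ^ 2) ∧ (∃ j, u j ≠ 0) ∧
      ∀ 𝔪 : Ideal A, 𝔪.IsMaximal → ¬ 𝔭 ≤ 𝔪 →
        Function.Surjective (linCombQuotSq (k := k) u 𝔪) := by
  classical
  obtain ⟨T, hT⟩ := (IsNoetherian.noetherian (𝔭 ^ 2) : (𝔭 ^ 2).FG)
  obtain ⟨s, hs⟩ := (Algebra.FiniteType.out : (⊤ : Subalgebra k A).FG)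
  have hsub : (T : Set A) ⊆ ↑(𝔭 ^ 2) := hT ▸ Ideal.subset_span
  refine ⟨↥T × Option ↥s, inferInstance, fun p => (p.1 : A) * p.2.elim 1 Subtype.val,
    fun p => Ideal.mul_mem_right _ _ (hsub p.1.2), ?_,
    fun 𝔪 h𝔪 hp𝔪 => surjective_linCombQuotSq_sqSystem hT hs 𝔪 hp𝔪⟩
  -- a non-zero generator of `𝔭² ≠ 0`
  have hne : 𝔭 ^ 2 ≠ ⊥ := pow_ne_zero 2 h𝔭
  have hex : ∃ g ∈ (T : Set A), g ≠ 0 := by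
    by_contra hcon
    push Not at hcon
    apply hne
    rw [← hT, Ideal.span_eq_bot]
    exact hcon
  obtain ⟨g, hgT, hg0⟩ := hex
  exact ⟨(⟨g, hgT⟩, none), by simpa using hg0⟩

/-! ## H-L0b: the singular locus of the generic member of the `𝔭²`-system -/

/-- **H-L0b `occurs_as_singular_locus`, affine kernel core** (CRUX-PLAN v3.0.1 §1.3 (b) «every
smooth connected `Σ ⊂ ℙ³_k` occurs: `H := V(G)`, `G` generic in `H⁰(𝓘_Σ²(d))`, `d ≫ 0`, … with
`Sing H = Σ`», the clause `Sing H = Σ` chart by chart). Let `A` be a regular domain of finite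
type over an algebraically closed field `k` and `𝔭 ⊆ A` a non-zero ideal. Then there are finitely
many functions `uⱼ ∈ 𝔭²` (the affine `𝔭²`-system `{g · 1, g · xᵢ}`) such that for GENERIC
coefficient vectors `t` (off the zeros of a non-zero polynomial; `k` is infinite, so such `t`
exist, `IsGeneric.nonempty`): `s_t = Σ tⱼ uⱼ` is non-zero, lies in `𝔭²` (so `V(𝔭) ⊆ V(s_t)`), and
for every closed point `𝔪` of the hypersurface `V(s_t)` the local ring `A_𝔪 ⧸ (s_t)` is regular
**iff** `𝔪 ⊉ 𝔭` — the closed singular points of `V(s_t)` are exactly those of `V(𝔭)`. Proof: Bertini off `V(𝔭)`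
(`isGeneric_isRegularLocalRing_quotient_linComb_off`) for the regular direction, Matsumura 14.2
(`not_isRegularLocalRing_quotient_of_mem_sq`, `s_t ∈ 𝔭² ⊆ 𝔪²`) for the singular one, and
`isGeneric_linComb_ne_zero`. NOT covered: integrality of `V(s_t)` for `d ≫ 0`, transversal type
`A₁` off finitely many points, projective gluing (see the module docstring). [cite: Hartshorne1977,
II Thm. 8.18] [cite: Matsumura1987, Thm. 14.2] [OURS · L1 W4.5b] helper H-L0b toward `stub_elnat_three`
of crux `EquisingularLiftNat` (stmt-ResolutionOfSingularities-20038); NOT a statement of the manuscript. -/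
theorem occurs_as_singular_locus [IsAlgClosed k] [IsRegularRing A] [IsDomain A]
    [Algebra.FiniteType k A] (𝔭 : Ideal A) (h𝔭 : 𝔭 ≠ ⊥) :
    ∃ (ι : Type u) (_ : Fintype ι) (u : ι → A), (∀ j, u j ∈ 𝔭 ^ 2) ∧
      IsGeneric fun t : ι → k =>
        linComb u t ≠ 0 ∧ linComb u t ∈ 𝔭 ^ 2 ∧
        ∀ (𝔪 : Ideal A) [𝔪.IsMaximal], linComb u t ∈ 𝔪 →
          (IsRegularLocalRing (Localization.AtPrime 𝔪 ⧸
              Ideal.span {algebraMap A (Localization.AtPrime 𝔪) (linComb u t)}) ↔ ¬ 𝔭 ≤ 𝔪) := by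
  classical
  obtain ⟨ι, hι, u, hu2, hune, hoff⟩ := exists_sqSystem (k := k) 𝔭 h𝔭
  refine ⟨ι, hι, u, hu2, ?_⟩
  have hmem : ∀ t : ι → k, linComb u t ∈ 𝔭 ^ 2 := fun t =>
    Ideal.sum_mem _ fun j _ => by rw [Algebra.smul_def]; exact Ideal.mul_mem_left _ _ (hu2 j)
  have hA := isGeneric_isRegularLocalRing_quotient_linComb_off (k := k) 𝔭 u hoff
  have hB := isGeneric_linComb_ne_zero (k := k) u hune
  refine (hA.and hB).mono fun t ht => ⟨ht.2, hmem t, fun 𝔪 h𝔪 hst => ⟨fun hreg => ?_, fun hp𝔪 => ?_⟩⟩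
  · -- regular at `𝔪` forces `𝔪 ⊉ 𝔭`
    intro hp𝔪
    have hs2 : linComb u t ∈ 𝔪 ^ 2 := Ideal.pow_right_mono hp𝔪 2 (hmem t)
    exact not_isRegularLocalRing_quotient_of_mem_sq 𝔪 ht.2 hs2 hreg
  · exact ht.1 𝔪 hp𝔪 hst

/-- **Corollary (a witness exists).** Under the hypotheses of `occurs_as_singular_locus` some
non-zero `s ∈ 𝔭²` has `Sing V(s) ∩ MaxSpec A = V(𝔭) ∩ MaxSpec A` (`k` is infinite,
`IsGeneric.nonempty`). [OURS · L1 W4.5b] helper H-L0b; NOT a statement of the manuscript. -/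
theorem exists_hypersurface_singularLocus_eq [IsAlgClosed k] [IsRegularRing A] [IsDomain A]
    [Algebra.FiniteType k A] (𝔭 : Ideal A) (h𝔭 : 𝔭 ≠ ⊥) :
    ∃ s : A, s ≠ 0 ∧ s ∈ 𝔭 ^ 2 ∧
      ∀ (𝔪 : Ideal A) [𝔪.IsMaximal], s ∈ 𝔪 →
        (IsRegularLocalRing (Localization.AtPrime 𝔪 ⧸
            Ideal.span {algebraMap A (Localization.AtPrime 𝔪) s}) ↔ ¬ 𝔭 ≤ 𝔪) := by
  obtain ⟨ι, hι, u, -, hgen⟩ := occurs_as_singular_locus (k := k) 𝔭 h𝔭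
  haveI : Infinite k := IsAlgClosed.instInfinite
  obtain ⟨t, ht⟩ := hgen.nonempty
  exact ⟨linComb u t, ht.1, ht.2.1, fun 𝔪 h𝔪 hst => ht.2.2 𝔪 hst⟩

end Summit.ResolutionOfSingularities.ResolutionOfSingularities.Cruxes.EquisingularLiftNat.Sections

end
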